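import Literature.Geometry.Manifold.CechSmoothSingular
import Literature.Geometry.Manifold.DeRhamMap
import Literature.Geometry.Kaehler.HolomorphicLineBundle
import Literature.Algebra.Homology.DoubleComplexZigzag
import HarnessLib

/-!
# The de Rham zigzag of a closed `2`-form inside the Čech–smooth-singular double complex

For an open family `𝔘 = (U_i)` of a `C^∞` manifold `M` and a smooth closed real `2`-form `θ`
resolved by a ZIGZAG — `θ = dα_i` on `U_i` (`α_i` smooth `1`-forms on `U_i`), `α_i − α_j = df_ij` on
`U_i ∩ U_j` (`f_ij` smooth functions), `f_ij + f_jk − f_ik = c_ijk` (constants) on `U_i ∩ U_j ∩ U_k` —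
integration over smooth simplices (the de Rham homomorphism, `Literature.Geometry.Manifold.deRhamMap`
/ `integrationFunctional`; Stokes' formula `integrationFunctional_localD`) carries the zigzag into
the Čech–smooth-singular double complex `C^p(𝔘, C^q_{sm})` of
`Literature.Geometry.Manifold.CechSmoothSingular`: with

* `A = ∫θ` — the smooth `𝔘`-small `2`-cocycle `c ↦ ∫_c θ` (`intSmallCochain`, a cocycle since
  `dθ = 0`),
* `b = (c_J)` — the Čech `2`-cochain of CONSTANT smooth `0`-cocycles (`cechConstCochain`, a Čech cocycle
  by the relations among the `c_ijk`),
* `x = (∫α_i)_i ⊕ (−ev f_ij)_{ij}` — homogeneous of total degree `1`,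

one has **`(ε A at (0,2)) − (η b at (2,0)) = D x`** (`cechSmoothSingular_deRham_zigzag`), the
hypothesis of the collating formula `ADoubleComplex.rowColEquiv_mk_eq_mk_of_totalD`; hence, when the
finite intersections are acyclic for smooth cochains, the Čech comparison isomorphism sends the class of
`∫θ` to the class of the constant cocycle `c`:
**`cechSmoothSingularEquiv [∫θ] = [c]`** (`cechSmoothSingularEquiv_intSmall_eq`). (Weil 1952, §3;
Bott–Tu (1982), Thm. 8.9 with Prop. 9.5 and Thm. 15.8: "the isomorphism is induced by integration".)
This is the de Rham half of the Čech integrality step of Lefschetz's theorem on `(1,1)`-classes.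

Also: the integration cochains `intSCochain A k η : Hom_ℝ(Δ^{sm}_k(A), ℝ)` with Stokes
(`scod_intSCochain`), restriction (`scres_intSCochain`), locality (`intSCochain_congr`) and values
(`sEvalSimplex_intSCochain`). No named facts; everything is proved.

## References

* A. Weil, *Sur les théorèmes de de Rham*, Comment. Math. Helv. 26 (1952), §3.
* R. Bott, L. W. Tu, *Differential Forms in Algebraic Topology* (1982), Thm. 8.9, Prop. 9.5,
  Thm. 15.8. [BottTu1982Forms]
* G. E. Bredon, *Topology and Geometry* (1993), §V.5, §V.9. [Bredon1993]
-/

noncomputable section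

-- as in `CechSingular`: chains of the concrete complex are `Finsupp`s up to unfolding
set_option backward.isDefEq.respectTransparency false

open scoped Manifold ContDiff
open CategoryTheory Literature.Algebra.Homology Literature.Algebra.Homology.ADoubleComplex
  Literature.AlgebraicTopology.SingularHomology Literature.Geometry.Kaehler

universe u

namespace Literature.Geometry.Manifold

variable {E : Type u} [NormedAddCommGroup E] [NormedSpace ℝ E]
  {H : Type u} [TopologicalSpace H] {I : ModelWithCorners ℝ E H}
  {M : Type u} [TopologicalSpace M] [ChartedSpace H M]

/-! ### Integration cochains on the smooth chains of a subset -/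

/-- **The integration cochain of a `k`-form on the smooth `k`-chains of `A`**: `c ↦ ∫_c η`
(`integrationFunctional` restricted to `Δ^{sm}_k(A)`), a concrete smooth cochain
`SCochainOn I ℝ ℝ A k`. [cite: Bredon1993, §V.5] -/
def intSCochain (A : Set M) (k : ℕ) (η : MForm I M ℝ k) : SCochainOn I ℝ ℝ A k :=
  (integrationFunctional η) ∘ₗ (smoothChainsInSub I ℝ ℝ M A k).subtype

/-- Values of the integration cochain. [folklore] -/
theorem intSCochain_apply (A : Set M) (k : ℕ) (η : MForm I M ℝ k)
    (c : (smoothChainsInSub I ℝ ℝ M A).toComplex.X k) :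
    intSCochain A k η c = integrationFunctional η c.1 :=
  rfl

/-- The integration cochain on a smooth simplex of `A` is the integral over the simplex. [folklore] -/
theorem sEvalSimplex_intSCochain {A : Set M} {k : ℕ} (η : MForm I M ℝ k) {σ : SingularSimplex M k}
    (hσ : IsSmoothIn I A σ) : sEvalSimplex (intSCochain A k η) σ = σ.formIntegral η := by
  rw [sEvalSimplex_of_isSmoothIn _ hσ]
  change integrationFunctional η (Finsupp.single σ 1) = _
  rw [integrationFunctional_single, one_mul]

/-- Restriction of integration cochains along `A ⊆ B`. [folklore] -/
theorem scres_intSCochain {A B : Set M} (h : A ⊆ B) (k : ℕ) (η : MForm I M ℝ k) :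
    scres h k (intSCochain B k η) = intSCochain A k η :=
  LinearMap.ext fun c ↦ by
    rw [scres_apply, intSCochain_apply, intSCochain_apply, Subcomplex.incl_f_apply_val]

/-- **Locality**: forms which agree at the points of `A` have the same integration cochain on `A`.
[folklore] -/
theorem intSCochain_congr {A : Set M} {k : ℕ} {η₁ η₂ : MForm I M ℝ k} (h : ∀ x ∈ A, η₁ x = η₂ x) :
    intSCochain A k η₁ = intSCochain A k η₂ := by
  refine ext_sEvalSimplex fun σ hσ ↦ ?_
  rw [sEvalSimplex_intSCochain _ hσ, sEvalSimplex_intSCochain _ hσ]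
  exact σ.formIntegral_congr fun x hx ↦ h x (hσ.2 hx)

/-- The integration cochain of a restricted form. [folklore] -/
theorem intSCochain_restr {A B : Set M} (h : A ⊆ B) (k : ℕ) (η : MForm I M ℝ k) :
    intSCochain A k (η.restr B) = intSCochain A k η :=
  intSCochain_congr fun _ hx ↦ MForm.restr_apply_of_mem η (h hx)

/-- The integration cochain is homogeneous in the form. [folklore] -/
theorem intSCochain_smul (A : Set M) (k : ℕ) (a : ℝ) (η : MForm I M ℝ k) :
    intSCochain A k (a • η) = a • intSCochain A k η :=
  LinearMap.ext fun c ↦ by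
    rw [intSCochain_apply, LinearMap.smul_apply, intSCochain_apply, integrationFunctional_smul, smul_eq_mul]

/-- Integration cochains of `0`-forms: `(∫ g)(x) = g(x)` on `0`-simplices, so they are additive with no
smoothness hypothesis. [folklore] -/
theorem intSCochain_ofFun_add (A : Set M) (g₁ g₂ : M → ℝ) :
    intSCochain A 0 (MForm.ofFun I (g₁ + g₂)) =
      intSCochain A 0 (MForm.ofFun I g₁) + intSCochain A 0 (MForm.ofFun I g₂) := by
  refine ext_sEvalSimplex fun σ hσ ↦ ?_
  rw [sEvalSimplex_add, sEvalSimplex_intSCochain _ hσ, sEvalSimplex_intSCochain _ hσ,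
    sEvalSimplex_intSCochain _ hσ, SingularSimplex.formIntegral_eq_of_zero,
    SingularSimplex.formIntegral_eq_of_zero, SingularSimplex.formIntegral_eq_of_zero]
  rfl

/-- Integration cochains of `0`-forms are compatible with negation. [folklore] -/
theorem intSCochain_ofFun_neg (A : Set M) (g : M → ℝ) :
    intSCochain A 0 (MForm.ofFun I (-g)) = -intSCochain A 0 (MForm.ofFun I g) := by
  refine ext_sEvalSimplex fun σ hσ ↦ ?_
  have h : sEvalSimplex (-intSCochain A 0 (MForm.ofFun I g)) σ =
      -sEvalSimplex (intSCochain A 0 (MForm.ofFun I g)) σ := by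
    rw [sEvalSimplex_of_isSmoothIn _ hσ, sEvalSimplex_of_isSmoothIn _ hσ, LinearMap.neg_apply]
  rw [h, sEvalSimplex_intSCochain _ hσ, sEvalSimplex_intSCochain _ hσ,
    SingularSimplex.formIntegral_eq_of_zero, SingularSimplex.formIntegral_eq_of_zero]
  rfl

/-- **Locality for `0`-forms**: functions which agree on `A` give the same integration cochain on `A`.
[folklore] -/
theorem intSCochain_ofFun_congr {A : Set M} {g₁ g₂ : M → ℝ} (h : ∀ x ∈ A, g₁ x = g₂ x) :
    intSCochain A 0 (MForm.ofFun I g₁) = intSCochain A 0 (MForm.ofFun I g₂) :=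
  intSCochain_congr fun x hx ↦ by
    ext v
    rw [MForm.ofFun_apply, MForm.ofFun_apply, h x hx]

variable [IsManifold I ∞ M]

/-- The integration cochain is additive in the form, for forms smooth at the points of `A`
(`formIntegral_add`). [folklore] -/
theorem intSCochain_add {A : Set M} {k : ℕ} {η₁ η₂ : MForm I M ℝ k}
    (h₁ : ∀ x ∈ A, η₁.SmoothAt x) (h₂ : ∀ x ∈ A, η₂.SmoothAt x) :
    intSCochain A k (η₁ + η₂) = intSCochain A k η₁ + intSCochain A k η₂ := by
  refine ext_sEvalSimplex fun σ hσ ↦ ?_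
  rw [sEvalSimplex_add, sEvalSimplex_intSCochain _ hσ, sEvalSimplex_intSCochain _ hσ,
    sEvalSimplex_intSCochain _ hσ]
  exact SingularSimplex.formIntegral_add hσ.1 (fun x hx ↦ h₁ x (hσ.2 hx)) (fun x hx ↦ h₂ x (hσ.2 hx))

/-- The integration cochain is compatible with subtraction, for forms smooth at the points of `A`.
[folklore] -/
theorem intSCochain_sub {A : Set M} {k : ℕ} {η₁ η₂ : MForm I M ℝ k}
    (h₁ : ∀ x ∈ A, η₁.SmoothAt x) (h₂ : ∀ x ∈ A, η₂.SmoothAt x) :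
    intSCochain A k (η₁ - η₂) = intSCochain A k η₁ - intSCochain A k η₂ := by
  have hn : intSCochain A k (-η₂) = -intSCochain A k η₂ := LinearMap.ext fun c ↦ by
    rw [intSCochain_apply, LinearMap.neg_apply, intSCochain_apply,
      show -η₂ = (-1 : ℝ) • η₂ from (neg_one_smul ℝ η₂).symm, integrationFunctional_smul]
    ring
  rw [sub_eq_add_neg, intSCochain_add h₁ (fun x hx ↦ (h₂ x hx).neg), hn, sub_eq_add_neg]

/-- **Stokes for integration cochains**: for a form `η` on the open set `A` (smooth at its points,
zero elsewhere), `δ(∫η) = ∫(d_A η)` on the smooth chains of `A`. [cite: LeeSmoothManifolds2013, Thm. 18.12] -/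
theorem scod_intSCochain {A : Set M} (hA : IsOpen A) {k : ℕ} (η : smoothFormsOn I ℝ A k) :
    scod A k (intSCochain A k (η : MForm I M ℝ k)) =
      intSCochain A (k + 1) (localD I ℝ k hA η : MForm I M ℝ (k + 1)) :=
  LinearMap.ext fun c ↦ by
    rw [scod_apply, intSCochain_apply, intSCochain_apply, toComplex_d_val,
      integrationFunctional_localD hA η c.2]

/-- **Stokes, pointwise form**: if `η` is smooth at the points of the open `A` and `dη = ω` there, then
`δ(∫η) = ∫ω` on the smooth chains of `A`. [cite: LeeSmoothManifolds2013, Thm. 18.12] -/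
theorem scod_intSCochain_of_mextDeriv_eq {A : Set M} (hA : IsOpen A) {k : ℕ} {η : MForm I M ℝ k}
    (hη : ∀ x ∈ A, η.SmoothAt x) {β : MForm I M ℝ (k + 1)} (hd : ∀ x ∈ A, mextDeriv η x = β x) :
    scod A k (intSCochain A k η) = intSCochain A (k + 1) β := by
  have hmem : η.restr A ∈ smoothFormsOn I ℝ A k :=
    ⟨fun x hx ↦ (MForm.smoothAt_restr_iff hA η hx).2 (hη x hx), fun x hx ↦ MForm.restr_apply_of_notMem η hx⟩
  rw [← intSCochain_restr (subset_refl A) k η, scod_intSCochain hA ⟨η.restr A, hmem⟩]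
  refine intSCochain_congr fun x hx ↦ ?_
  rw [coe_localD, MForm.restr_apply_of_mem _ hx, mextDeriv_restr_apply hA η hx, hd x hx]

/-! ### The global small cocycle `∫θ` and the constant Čech cochain -/

variable {ι : Type*} (U : ι → Set M)

omit [IsManifold I ∞ M] in
/-- Finite intersections of an open family are open. [folklore] -/
theorem isOpen_cechSet (hU : ∀ i, IsOpen (U i)) {n : ℕ} (J : Fin n → ι) : IsOpen (cechSet U J) :=
  isOpen_iInter_of_finite fun k ↦ hU (J k)

omit [IsManifold I ∞ M] in
/-- **The smooth `𝔘`-small integration cochain** `c ↦ ∫_c θ` of a `k`-form. [cite: Bredon1993, §V.5] -/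
def intSmallCochain (k : ℕ) (θ : MForm I M ℝ k) : SmoothSmallCochain I ℝ ℝ U k :=
  (integrationFunctional θ) ∘ₗ (smoothSmallSub I ℝ U k).subtype

omit [IsManifold I ∞ M] in
/-- The row augmentation of `∫θ` is `(∫θ on U_J)_J`. [folklore] -/
theorem cechSmoothSingularRow_ε_intSmall (k : ℕ) (θ : MForm I M ℝ k) (J : Fin 1 → ι) :
    (cechSmoothSingularRow I ℝ ℝ U).ε k (intSmallCochain U k θ) J = intSCochain (cechSet U J) k θ :=
  LinearMap.ext fun _ ↦ rfl

/-- **`∫θ` is a cocycle of the smooth small cochains when `θ` is a smooth closed form** (Stokes on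
`M`). [cite: LeeSmoothManifolds2013, Thm. 18.12] -/
theorem intSmallCochain_mem_cocycles {k : ℕ} {θ : MForm I M ℝ k} (hs : IsSmoothForm θ) (hc : IsClosedForm θ) :
    intSmallCochain U k θ ∈ NatCochain.cocycles (cechSmoothSingularRow I ℝ ℝ U).dA k := by
  rw [NatCochain.mem_cocycles_iff]
  refine LinearMap.ext fun c ↦ ?_
  change integrationFunctional θ ((smoothSmallSub I ℝ U).toComplex.d (k + 1) k c).1 = 0
  have hθ : θ.restr Set.univ ∈ smoothFormsOn I ℝ (Set.univ : Set M) k := by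
    rw [MForm.restr_univ]
    exact ⟨fun x _ ↦ hs x, fun x hx ↦ absurd (Set.mem_univ x) hx⟩
  have hcu : (c.1 : CChain ℝ M (k + 1)) ∈ smoothChainsInSub I ℝ ℝ M Set.univ (k + 1) := by
    rw [smoothChainsInSub_univ]
    exact c.2.1
  have h := integrationFunctional_localD isOpen_univ ⟨θ.restr Set.univ, hθ⟩ hcu
  have h0 : (localD I ℝ k isOpen_univ ⟨θ.restr Set.univ, hθ⟩ : MForm I M ℝ (k + 1)) = 0 := by
    rw [coe_localD]
    change (mextDeriv (θ.restr Set.univ)).restr Set.univ = 0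
    rw [MForm.restr_univ, MForm.restr_univ]
    exact hc
  rw [h0] at h
  have h2 : integrationFunctional ((⟨θ.restr Set.univ, hθ⟩ : smoothFormsOn I ℝ (Set.univ : Set M) k) :
      MForm I M ℝ k) (csingularChainComplex.bd ℝ k c.1) =
      integrationFunctional θ (csingularChainComplex.bd ℝ k c.1) := by
    change integrationFunctional (θ.restr Set.univ) _ = _
    rw [MForm.restr_univ]
  rw [toComplex_d_val, ← h2, ← h, integrationFunctional_apply]
  exact Finset.sum_eq_zero fun σ _ ↦ by rw [SingularSimplex.formIntegral_zero, mul_zero]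

/-- **The constant Čech `2`-cochain of smooth `0`-cocycles** attached to `c : ι³ → ℝ`: on `U_J`,
`J = (j₀, j₁, j₂)`, the integration cochain of the constant function `c_{j₀ j₁ j₂}` (value `c_J` on each
`0`-simplex of `U_J`), a smooth `0`-cocycle since constants have zero derivative. [folklore] -/
def cechConstCochain (I : ModelWithCorners ℝ E H) [IsManifold I ∞ M] (hU : ∀ i, IsOpen (U i))
    (c : ι → ι → ι → ℝ) : CechZeroSCocycles I ℝ ℝ U 2 :=
  fun J ↦ ⟨intSCochain (cechSet U J) 0 (MForm.ofFun I fun _ ↦ c (J 0) (J 1) (J 2)), by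
    have hsm : ∀ x : M, (MForm.ofFun I fun _ : M ↦ c (J 0) (J 1) (J 2)).SmoothAt x := fun x ↦ by
      rw [MForm.SmoothAt, MForm.inChart_ofFun_const]
      exact contDiffWithinAt_const
    rw [LinearMap.mem_ker, scod_intSCochain_of_mextDeriv_eq (isOpen_cechSet U hU J)
      (fun x _ ↦ hsm x) (β := 0) (fun x _ ↦ by rw [mextDeriv_ofFun_const])]
    refine LinearMap.ext fun x ↦ ?_
    rw [intSCochain_apply, integrationFunctional_apply, LinearMap.zero_apply]
    exact Finset.sum_eq_zero fun σ _ ↦ by rw [SingularSimplex.formIntegral_zero, mul_zero]⟩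

/-- The underlying cochain of the constant Čech cochain. [folklore] -/
theorem coe_cechConstCochain (hU : ∀ i, IsOpen (U i)) (c : ι → ι → ι → ℝ) (J : Fin 3 → ι) :
    ((cechConstCochain U I hU c J : zeroSCocycles I ℝ ℝ (cechSet U J)) : SCochainOn I ℝ ℝ (cechSet U J) 0) =
      intSCochain (cechSet U J) 0 (MForm.ofFun I fun _ ↦ c (J 0) (J 1) (J 2)) :=
  rfl


/-! ### Values of cochains: negation, subtraction, `0`-forms -/

omit [IsManifold I ∞ M] in
/-- `sEvalSimplex` is compatible with negation. [folklore] -/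
theorem sEvalSimplex_neg {R : Type*} [CommRing R] {N : Type*} [AddCommGroup N] [Module R N]
    {A : Set M} {q : ℕ} (ψ : SCochainOn I R N A q) (σ : SingularSimplex M q) :
    sEvalSimplex (-ψ) σ = -sEvalSimplex ψ σ := by
  by_cases h : IsSmoothIn I A σ
  · rw [sEvalSimplex_of_isSmoothIn _ h, sEvalSimplex_of_isSmoothIn _ h, LinearMap.neg_apply]
  · simp only [sEvalSimplex, dif_neg h, neg_zero]

omit [IsManifold I ∞ M] in
/-- `sEvalSimplex` is compatible with subtraction. [folklore] -/
theorem sEvalSimplex_sub {R : Type*} [CommRing R] {N : Type*} [AddCommGroup N] [Module R N]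
    {A : Set M} {q : ℕ} (ψ ψ' : SCochainOn I R N A q) (σ : SingularSimplex M q) :
    sEvalSimplex (ψ - ψ') σ = sEvalSimplex ψ σ - sEvalSimplex ψ' σ := by
  rw [sub_eq_add_neg, sEvalSimplex_add, sEvalSimplex_neg, sub_eq_add_neg]

omit [IsManifold I ∞ M] in
/-- The points of a smooth simplex of `A` lie in `A`. [folklore] -/
theorem IsSmoothIn.apply_mem {A : Set M} {q : ℕ} {σ : SingularSimplex M q} (hσ : IsSmoothIn I A σ)
    (t : stdSimplex ℝ (Fin (q + 1))) : SingularSimplex.toContinuousMap σ t ∈ A :=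
  hσ.2 ⟨t, rfl⟩

omit [IsManifold I ∞ M] in
/-- **The integration cochain of a function on a `0`-simplex is the value at the point.**
[cite: LeeSmoothManifolds2013, p. 481] -/
theorem sEvalSimplex_intSCochain_ofFun {A : Set M} (g : M → ℝ) {σ : SingularSimplex M 0}
    (hσ : IsSmoothIn I A σ) :
    sEvalSimplex (intSCochain A 0 (MForm.ofFun I g)) σ = g (SingularSimplex.toContinuousMap σ default) := by
  rw [sEvalSimplex_intSCochain _ hσ, SingularSimplex.formIntegral_eq_of_zero]
  rfl

/-! ### The zigzag of a resolved closed `2`-form -/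

/-- `single p q` is compatible with negation. [folklore] -/
theorem _root_.Literature.Algebra.Homology.ADoubleComplex.single_neg {X : ℕ → ℕ → Type*}
    [∀ p q, AddCommGroup (X p q)] (p q : ℕ) (v : X p q) : single p q (-v) = -single p q v :=
  eq_neg_of_add_eq_zero_left (by rw [← single_add, neg_add_cancel, single_zero])

section Zigzag

variable {U}

/-- The `(0,1)` component of the zigzag: `J = (j) ↦ ∫ α_j` on `U_j`. [cite: BottTu1982Forms, §8 Ex. 8.7] -/
def zigzagX01 (α : ι → MForm I M ℝ 1) : CechSCochain I ℝ ℝ U 0 1 :=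
  fun J ↦ intSCochain (cechSet U J) 1 (α (J 0))

/-- The `(1,0)` component of the zigzag: `J = (i, j) ↦ −ev f_ij` on `U_i ∩ U_j`.
[cite: BottTu1982Forms, §8 Ex. 8.7] -/
def zigzagX10 (I : ModelWithCorners ℝ E H) (f : ι → ι → M → ℝ) : CechSCochain I ℝ ℝ U 1 0 :=
  fun J ↦ -intSCochain (cechSet U J) 0 (MForm.ofFun I (f (J 0) (J 1)))

/-- The zigzag total `1`-cochain `x = (∫α_i)_i ⊕ (−ev f_ij)_{ij}`. [cite: BottTu1982Forms, §8 Ex. 8.7] -/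
def zigzagX (α : ι → MForm I M ℝ 1) (f : ι → ι → M → ℝ) : ∀ p q, CechSCochain I ℝ ℝ U p q :=
  single 0 1 (zigzagX01 (U := U) α) + single 1 0 (zigzagX10 (U := U) I f)

omit [IsManifold I ∞ M] in
/-- The zigzag cochain is homogeneous of total degree `1`. [folklore] -/
theorem zigzagX_mem_Tn (α : ι → MForm I M ℝ 1) (f : ι → ι → M → ℝ) :
    zigzagX (U := U) α f ∈ Tn ℝ 1 :=
  add_mem (single_mem_Tn ℝ 0 1 _) (single_mem_Tn ℝ 1 0 _)

variable (hU : ∀ i, IsOpen (U i)) {θ : MForm I M ℝ 2} {α : ι → MForm I M ℝ 1} {f : ι → ι → M → ℝ}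
  {c : ι → ι → ι → ℝ}

include hU in
/-- **First step of the zigzag**: `d(∫α_j) = ∫θ` on `U_j` (Stokes and `dα_j = θ`), i.e. the vertical
differential of the `(0,1)` component is the augmentation of `∫θ`. [cite: BottTu1982Forms, Prop. 9.5] -/
theorem cechSd_zigzagX01 (hα : ∀ i, ∀ x ∈ U i, (α i).SmoothAt x)
    (hdα : ∀ i, ∀ x ∈ U i, mextDeriv (α i) x = θ x) :
    cechSd I ℝ ℝ U 0 1 (zigzagX01 (U := U) α) =
      (cechSmoothSingularRow I ℝ ℝ U).ε 2 (intSmallCochain U 2 θ) := by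
  funext J
  rw [cechSd_apply, pow_zero, cechSmoothSingularRow_ε_intSmall]
  refine ext_sEvalSimplex fun σ hσ ↦ ?_
  rw [sEvalSimplex_smul, one_smul]
  congr 1
  exact scod_intSCochain_of_mextDeriv_eq (isOpen_cechSet U hU J)
    (fun x hx ↦ hα (J 0) x (cechSet_subset_apply U J 0 hx))
    (fun x hx ↦ hdα (J 0) x (cechSet_subset_apply U J 0 hx))

include hU in
/-- **Middle step of the zigzag**: `δ(∫α)_{ij} = ∫α_j − ∫α_i = −d(ev f_ij)` on `U_i ∩ U_j` (Stokes and
`df_ij = α_i − α_j`): the `(1,1)` entry of `D x` vanishes. [cite: BottTu1982Forms, Prop. 9.5] -/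
theorem cechSδ_zigzagX01_add_cechSd_zigzagX10 (hα : ∀ i, ∀ x ∈ U i, (α i).SmoothAt x)
    (hfs : ∀ i j, ∀ x ∈ U i ∩ U j, (MForm.ofFun I (f i j)).SmoothAt x)
    (hdf : ∀ i j, ∀ x ∈ U i ∩ U j, mextDeriv (MForm.ofFun I (f i j)) x = α i x - α j x) :
    cechSδ I ℝ ℝ U 0 1 (zigzagX01 (U := U) α) + cechSd I ℝ ℝ U 1 0 (zigzagX10 (U := U) I f) = 0 := by
  funext J
  have hJ : ∀ x ∈ cechSet U J, x ∈ U (J 0) ∩ U (J 1) := fun x hx ↦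
    ⟨cechSet_subset_apply U J 0 hx, cechSet_subset_apply U J 1 hx⟩
  -- Stokes for `f_{J0 J1}` on `U_J`
  have hd : scod (cechSet U J) 0 (intSCochain (cechSet U J) 0 (MForm.ofFun I (f (J 0) (J 1)))) =
      intSCochain (cechSet U J) 1 (α (J 0)) - intSCochain (cechSet U J) 1 (α (J 1)) := by
    rw [scod_intSCochain_of_mextDeriv_eq (isOpen_cechSet U hU J) (fun x hx ↦ hfs _ _ x (hJ x hx))
      (fun x hx ↦ hdf _ _ x (hJ x hx))]
    exact intSCochain_sub (fun x hx ↦ hα _ x (hJ x hx).1) (fun x hx ↦ hα _ x (hJ x hx).2)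
  rw [Pi.add_apply, Pi.zero_apply, cechSδ_apply, cechSd_apply, Fin.sum_univ_two]
  simp only [zigzagX01, zigzagX10, Function.comp_apply, Fin.succAbove_zero, Fin.one_succAbove_zero,
    Fin.succ_zero_eq_one, Fin.val_zero, Fin.val_one, pow_zero, pow_one, scres_intSCochain, map_neg, hd]
  refine ext_sEvalSimplex fun σ _ ↦ ?_
  rw [sEvalSimplex_add, sEvalSimplex_add, sEvalSimplex_smul, sEvalSimplex_smul, sEvalSimplex_smul,
    sEvalSimplex_neg, sEvalSimplex_sub]
  rw [show sEvalSimplex (0 : SCochainOn I ℝ ℝ (cechSet U J) 1) σ = 0 by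
    by_cases h : IsSmoothIn I (cechSet U J) σ
    · rw [sEvalSimplex_of_isSmoothIn _ h, LinearMap.zero_apply]
    · simp only [sEvalSimplex, dif_neg h]]
  simp only [smul_eq_mul]
  ring

include hU in
/-- **Last step of the zigzag**: `δ(−ev f)_{ijk} = −(f_jk − f_ik + f_ij) = −c_ijk` on `U_i ∩ U_j ∩ U_k`:
the horizontal differential of the `(1,0)` component is minus the augmentation of the constant Čech
cochain `c`. [cite: BottTu1982Forms, Prop. 9.5] -/
theorem cechSδ_zigzagX10 (hc : ∀ i j k, ∀ x ∈ U i ∩ U j ∩ U k, f i j x + f j k x - f i k x = c i j k) :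
    cechSδ I ℝ ℝ U 1 0 (zigzagX10 (U := U) I f) =
      -(cechZeroSIncl I ℝ ℝ U 2 (cechConstCochain U I hU c)) := by
  funext J
  rw [Pi.neg_apply]
  change _ = -((cechConstCochain U I hU c J : zeroSCocycles I ℝ ℝ (cechSet U J)) :
    SCochainOn I ℝ ℝ (cechSet U J) 0)
  rw [coe_cechConstCochain, cechSδ_apply, Fin.sum_univ_three]
  simp only [zigzagX10, Function.comp_apply, Fin.succAbove_zero, Fin.one_succAbove_zero,
    Fin.one_succAbove_one, Fin.succ_zero_eq_one, Fin.succ_one_eq_two, Fin.val_zero, Fin.val_one,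
    Fin.val_two, pow_zero, pow_one, map_neg, scres_intSCochain]
  refine ext_sEvalSimplex fun σ hσ ↦ ?_
  have hx := hc (J 0) (J 1) (J 2) (SingularSimplex.toContinuousMap σ default)
    ⟨⟨cechSet_subset_apply U J 0 (hσ.apply_mem default), cechSet_subset_apply U J 1 (hσ.apply_mem default)⟩,
      cechSet_subset_apply U J 2 (hσ.apply_mem default)⟩
  have h2 : (Fin.succAbove (2 : Fin 3) 0 : Fin 3) = 0 := rfl
  have h2' : (Fin.succAbove (2 : Fin 3) 1 : Fin 3) = 1 := rfl
  simp only [h2, h2', sEvalSimplex_add, sEvalSimplex_smul, sEvalSimplex_neg,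
    sEvalSimplex_intSCochain_ofFun _ hσ, smul_eq_mul]
  linarith

include hU in
/-- **The constant Čech cochain of a zigzag is a Čech cocycle**: the alternating sum of the `c_J`
over the faces of a `4`-tuple vanishes on `U_J` (by the relations `f_ij + f_jk − f_ik = c_ijk`; and
trivially when `U_J = ∅`). [cite: BottTu1982Forms, §8 Ex. 8.7] -/
theorem cechConstCochain_mem_cocycles
    (hc : ∀ i j k, ∀ x ∈ U i ∩ U j ∩ U k, f i j x + f j k x - f i k x = c i j k) :
    cechConstCochain U I hU c ∈ NatCochain.cocycles (cechZeroSδ I ℝ ℝ U) 2 := by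
  rw [NatCochain.mem_cocycles_iff]
  funext J
  apply Subtype.ext
  rw [coe_cechZeroSδ_apply, Fin.sum_univ_four]
  simp only [coe_cechConstCochain, Function.comp_apply, scres_intSCochain]
  change _ = (0 : SCochainOn I ℝ ℝ (cechSet U J) 0)
  refine ext_sEvalSimplex fun σ hσ ↦ ?_
  have hm : ∀ k, SingularSimplex.toContinuousMap σ default ∈ U (J k) := fun k ↦
    cechSet_subset_apply U J k (hσ.apply_mem default)
  have h123 := hc (J 1) (J 2) (J 3) _ ⟨⟨hm 1, hm 2⟩, hm 3⟩
  have h023 := hc (J 0) (J 2) (J 3) _ ⟨⟨hm 0, hm 2⟩, hm 3⟩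
  have h013 := hc (J 0) (J 1) (J 3) _ ⟨⟨hm 0, hm 1⟩, hm 3⟩
  have h012 := hc (J 0) (J 1) (J 2) _ ⟨⟨hm 0, hm 1⟩, hm 2⟩
  have e00 : (Fin.succAbove (0 : Fin 4) 0 : Fin 4) = 1 := rfl
  have e01 : (Fin.succAbove (0 : Fin 4) 1 : Fin 4) = 2 := rfl
  have e02 : (Fin.succAbove (0 : Fin 4) 2 : Fin 4) = 3 := rfl
  have e10 : (Fin.succAbove (1 : Fin 4) 0 : Fin 4) = 0 := rfl
  have e11 : (Fin.succAbove (1 : Fin 4) 1 : Fin 4) = 2 := rfl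
  have e12 : (Fin.succAbove (1 : Fin 4) 2 : Fin 4) = 3 := rfl
  have e20 : (Fin.succAbove (2 : Fin 4) 0 : Fin 4) = 0 := rfl
  have e21 : (Fin.succAbove (2 : Fin 4) 1 : Fin 4) = 1 := rfl
  have e22 : (Fin.succAbove (2 : Fin 4) 2 : Fin 4) = 3 := rfl
  have e30 : (Fin.succAbove (3 : Fin 4) 0 : Fin 4) = 0 := rfl
  have e31 : (Fin.succAbove (3 : Fin 4) 1 : Fin 4) = 1 := rfl
  have e32 : (Fin.succAbove (3 : Fin 4) 2 : Fin 4) = 2 := rfl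
  have h0 : sEvalSimplex (0 : SCochainOn I ℝ ℝ (cechSet U J) 0) σ = 0 := by
    rw [sEvalSimplex_of_isSmoothIn _ hσ, LinearMap.zero_apply]
  simp only [e00, e01, e02, e10, e11, e12, e20, e21, e22, e30, e31, e32, sEvalSimplex_add,
    sEvalSimplex_smul, sEvalSimplex_intSCochain_ofFun _ hσ, smul_eq_mul, h0,
    Fin.val_zero, Fin.val_one, Fin.val_two, pow_zero, pow_one]
  have e3 : ((3 : Fin 4) : ℕ) = 3 := rfl
  simp only [e3]
  linarith

include hU in
/-- **The de Rham zigzag**: with `A = ∫θ`, `b = (c_J)` and `x = (∫α_i) ⊕ (−ev f_ij)`,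
`(ε A at (0,2)) − (η b at (2,0)) = D x` in the Čech–smooth-singular double complex.
[cite: BottTu1982Forms, Prop. 9.5] -/
theorem cechSmoothSingular_deRham_zigzag (hα : ∀ i, ∀ x ∈ U i, (α i).SmoothAt x)
    (hdα : ∀ i, ∀ x ∈ U i, mextDeriv (α i) x = θ x)
    (hfs : ∀ i j, ∀ x ∈ U i ∩ U j, (MForm.ofFun I (f i j)).SmoothAt x)
    (hdf : ∀ i j, ∀ x ∈ U i ∩ U j, mextDeriv (MForm.ofFun I (f i j)) x = α i x - α j x)
    (hc : ∀ i j k, ∀ x ∈ U i ∩ U j ∩ U k, f i j x + f j k x - f i k x = c i j k) :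
    single 0 2 ((cechSmoothSingularRow I ℝ ℝ U).ε 2 (intSmallCochain U 2 θ)) -
        single 2 0 ((cechSmoothSingularCol I ℝ ℝ U).ε 2 (cechConstCochain U I hU c)) =
      (cechSmoothSingular I ℝ ℝ U).totalD (zigzagX (U := U) α f) := by
  rw [zigzagX, map_add, totalD_single, totalD_single]
  change single 0 2 ((cechSmoothSingularRow I ℝ ℝ U).ε 2 (intSmallCochain U 2 θ)) -
      single 2 0 (cechZeroSIncl I ℝ ℝ U 2 (cechConstCochain U I hU c)) =
    single 1 1 (cechSδ I ℝ ℝ U 0 1 (zigzagX01 α)) + single 0 2 (cechSd I ℝ ℝ U 0 1 (zigzagX01 α)) +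
      (single 2 0 (cechSδ I ℝ ℝ U 1 0 (zigzagX10 I f)) + single 1 1 (cechSd I ℝ ℝ U 1 0 (zigzagX10 I f)))
  rw [cechSd_zigzagX01 hU hα hdα, cechSδ_zigzagX10 hU hc,
    show cechSδ I ℝ ℝ U 0 1 (zigzagX01 (U := U) α) = -cechSd I ℝ ℝ U 1 0 (zigzagX10 (U := U) I f) from
      eq_neg_of_add_eq_zero_left (cechSδ_zigzagX01_add_cechSd_zigzagX10 hU hα hfs hdf),
    single_neg, single_neg]
  abel

/-- **The Čech comparison isomorphism sends `[∫θ]` to the class of the constant cocycle `c`** of any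
zigzag resolving `θ`, when the finite intersections of `𝔘` are acyclic for smooth cochains ("the
isomorphism is induced by integration": Bott–Tu (1982), Thm. 8.9 with Prop. 9.5, Thm. 15.8; Weil
(1952), §3). [cite: BottTu1982Forms, Prop. 9.5] -/
theorem cechSmoothSingularEquiv_intSmall_eq
    (hacyc : ∀ (p q : ℕ) (J : Fin (p + 1) → ι) (ψ : SCochainOn I ℝ ℝ (cechSet U J) (q + 1)),
      scod (cechSet U J) (q + 1) ψ = 0 → ∃ φ : SCochainOn I ℝ ℝ (cechSet U J) q, scod (cechSet U J) q φ = ψ)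
    (hs : IsSmoothForm θ) (hcl : IsClosedForm θ)
    (hα : ∀ i, ∀ x ∈ U i, (α i).SmoothAt x) (hdα : ∀ i, ∀ x ∈ U i, mextDeriv (α i) x = θ x)
    (hfs : ∀ i j, ∀ x ∈ U i ∩ U j, (MForm.ofFun I (f i j)).SmoothAt x)
    (hdf : ∀ i j, ∀ x ∈ U i ∩ U j, mextDeriv (MForm.ofFun I (f i j)) x = α i x - α j x)
    (hc : ∀ i j k, ∀ x ∈ U i ∩ U j ∩ U k, f i j x + f j k x - f i k x = c i j k) :
    cechSmoothSingularEquiv U hacyc 2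
        (NatCochain.Cohomology.mk _ 2 ⟨intSmallCochain U 2 θ, intSmallCochain_mem_cocycles U hs hcl⟩) =
      NatCochain.Cohomology.mk _ 2 ⟨cechConstCochain U I hU c, cechConstCochain_mem_cocycles hU hc⟩ :=
  ADoubleComplex.rowColEquiv_mk_eq_mk_of_totalD _ _ _ _ _ _ _ _ (zigzagX (U := U) α f)
    (zigzagX_mem_Tn α f) (cechSmoothSingular_deRham_zigzag hU hα hdα hfs hdf hc)

end Zigzag

end Literature.Geometry.Manifold

end
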